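import Summits.ValiantsHypothesis.ValiantsHypothesis.Theorems.KPlusLogSqLawTropicalBTightnessSubalphabet
import Summits.ValiantsHypothesis.ValiantsHypothesis.Theorems.KPlusLogSqLawTropicalBThreeFourOrderTypeLawMirror

/-!
# Route «KPlusLogSqLaw», crux `TropicalB` (stmt-ValiantsHypothesis-19771) — INHERITED NON-TIGHTNESS: every `(3,4)` order-type law is a `(3,5)`
# law five times over (delete a class, order-preservingly), and likewise at every format `(m, K+2)`

HONEST FRAMING.  Sequel of `…TropicalBTightnessSubalphabet` (seat val-sym-trop-p4 g12, cell `pub-symmetroid`, 2026-08-28; `--supports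
stmt-ValiantsHypothesis-19771 --as helper`) joining it to the `(3,4)` ORDER-TYPE LAWS of val-sym-trop-p5 g12 (`ThreeFourCore.designRowD_three_four_18_*`,
…ThreeFourOrderTypeLaw*, 34 of the 80 `(3,4)` order types are not counting-tight — kernel).  Census bookkeeping: nothing here bears on
`TropicalB` in its window, `WeakLifting`, DoorA26 / DoorA34, `MatrixDescartes` (stmt-ValiantsHypothesis-18050) or VP ≠ VNP.

* `exists_tight_chain_delete_succAbove` — the ORDER-PRESERVING form of class deletion: a counting-tight chain of format `(m, K+2)` restricts to a
  counting-tight chain of the design on the classes `≠ l` indexed by `l.succAbove` (relabel by `(Fin.cycleRange l)⁻¹`, then delete class `0`).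
* `designRowD_notTight_of_delete_succAbove` — exponent-level lift: if `j ↦ d (l.succAbove j)` admits no counting-tight design then neither does `d`
  (`m, K ≥ 1`).
* `designRowD_three_five_33_of_delete` — the `(3,5)` instance: a `(3,4)` law «`DesignRowD (d ∘ l.succAbove) v' ε' 18` for all `v', ε'`» gives
  `DesignRowD d v ε 33`, i.e. the `(3,5)` cell on `d` is NOT counting-tight (tight would be `35` terms, `34` breakpoints).
* instances: `designRowD_three_five_33_wedge_low` / `_wedge_high` (the WEDGE law of val-sym-trop-p5 on the four LOWER resp. UPPER classes),
  `designRowD_three_five_33_core_low` (the core law C1 on the lower classes), the families `(0,2,3,N,D)` (`N ≥ 7`, any `D`) and `(0,a,a,N,D)`.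
READING (located, this seat's exp/cover35.py over the 1944 `(3,5)` order types with `d₄ ≤ 40`): 1316 of them have at least one 4-class restriction
among the 34 kernel-non-tight `(3,4)` types, so the theorems here put THOSE `(3,5)` cells in the kernel as non-tight; with val-sym-trop-p4 g5's convex /
concave regions (`three_five_le_of_convex/concave`) 1397 are kernel; 547 order types of `(3,5)` remain located-only (all five restrictions tight
`(3,4)` types and outside g5's regions) — the residue between «κ(3) = 4 located» and «κ(3) = 4 kernel».  [this file; bookkeeping]
-/

set_option linter.dupNamespace false
set_option autoImplicit false

namespace Summit.ValiantsHypothesis.ValiantsHypothesis.Theorems.KPlusLogSqLaw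

open Summit.ValiantsHypothesis.ValiantsHypothesis.Theorems.MatrixDescartes.Negative
open Summit.ValiantsHypothesis.ValiantsHypothesis.Theorems.LacunarySymmetroidMatrixDescartes
open Summit.ValiantsHypothesis.ValiantsHypothesis.Theorems.LacunarySymmetroidMatrixDescartes.TropicalCensus
open scoped BigOperators
open Finset

namespace Tightness

variable {m K : ℕ}

/-- the inverse of the cycle `(0 1 … l)` sends `succ j` to `l.succAbove j`. [bookkeeping over `Fin.cycleRange_succAbove`] -/
theorem cycleRange_symm_succ (l : Fin (K + 2)) (j : Fin (K + 1)) : (Fin.cycleRange l).symm j.succ = l.succAbove j := by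
  rw [Equiv.symm_apply_eq]; exact (Fin.cycleRange_succAbove l j).symm

/-- **Order-preserving class deletion.**  A counting-tight unsigned chain of format `(m, K+2)` restricts, for every class `l`, to a counting-tight
unsigned chain of the design on the classes `≠ l` indexed increasingly by `l.succAbove`. [this file] -/
theorem exists_tight_chain_delete_succAbove {n : ℕ} (d : Fin (K + 2) → ℕ) (v ε : Fin m → Fin m → Fin (K + 2) → ℤ)
    (θ : Fin (n + 1) → ℤ) (p : Fin (n + 1) → Equiv.Perm (Fin m) × (Fin m → Fin (K + 2)))
    (hθ : StrictMono θ) (hdom : ∀ k, IsDominant d v ε (θ k) (p k)) (hne : ∀ k : Fin n, p k.castSucc ≠ p k.succ)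
    (htight : Nat.multichoose (K + 2) m ≤ n + 1) (l : Fin (K + 2)) :
    ∃ (n' : ℕ) (θ' : Fin (n' + 1) → ℤ) (p' : Fin (n' + 1) → Equiv.Perm (Fin m) × (Fin m → Fin (K + 1))),
      StrictMono θ' ∧
      (∀ k, IsDominant (fun j => d (l.succAbove j)) (fun a b j => v a b (l.succAbove j))
        (fun a b j => ε a b (l.succAbove j)) (θ' k) (p' k)) ∧
      (∀ k : Fin n', p' k.castSucc ≠ p' k.succ) ∧
      Nat.multichoose (K + 1) m ≤ n' + 1 := by
  set π : Equiv.Perm (Fin (K + 2)) := (Fin.cycleRange l).symm with hπ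
  obtain ⟨hdom', hne'⟩ := chain_relabelClasses π d v ε θ p hdom hne
  obtain ⟨n', θ', p', h1, h2, h3, h4⟩ := exists_tight_chain_delete (d ∘ π) (fun a b j => v a b (π j)) (fun a b j => ε a b (π j)) θ
    (fun k => ((p k).1, π.symm ∘ (p k).2)) hθ hdom' hne' htight
  have hπs : ∀ j : Fin (K + 1), π j.succ = l.succAbove j := fun j => cycleRange_symm_succ l j
  refine ⟨n', θ', p', h1, fun k => ?_, h3, h4⟩
  have hk := h2 k
  simp only [Function.comp, hπs] at hk
  exact hk

/-- **Non-tightness lifts from a sub-alphabet, order-preserving exponent-level form.**  If the restricted exponent vector `j ↦ d (l.succAbove j)`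
admits no counting-tight design of format `(m, K+1)` (for all valuations and supports), then `d` admits none of format `(m, K+2)` (`m, K ≥ 1`).
[this file] -/
theorem designRowD_notTight_of_delete_succAbove (hm : 1 ≤ m) (hK : 1 ≤ K) (d : Fin (K + 2) → ℕ) (l : Fin (K + 2))
    (h : ∀ v' ε' : Fin m → Fin m → Fin (K + 1) → ℤ,
      DesignRowD (fun j => d (l.succAbove j)) v' ε' (Nat.multichoose (K + 1) m - 2))
    (v ε : Fin m → Fin m → Fin (K + 2) → ℤ) : DesignRowD d v ε (Nat.multichoose (K + 2) m - 2) := by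
  intro n θ p hθ hdom hne
  by_contra hlt
  have htight : Nat.multichoose (K + 2) m ≤ n + 1 := by omega
  obtain ⟨n', θ', p', hθ', hdom', hne', htight'⟩ := exists_tight_chain_delete_succAbove d v ε θ p hθ hdom hne htight l
  have hle := h _ _ n' θ' p' hθ' hdom' hne'
  have hN : m + 1 ≤ Nat.multichoose (K + 1) m := by
    have h2 : Nat.multichoose 2 m ≤ Nat.multichoose (K + 1) m := by
      rw [Nat.multichoose_eq, Nat.multichoose_eq]
      exact Nat.choose_le_choose m (by omega)
    rw [Nat.multichoose_two] at h2
    exact h2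
  omega

/-! ### The `(3,5)` instances -/

/-- **Every `(3,4)` law is a `(3,5)` law:** if the restriction of `d : Fin 5 → ℕ` to the classes `≠ l` (in increasing order) satisfies
«`DesignRowD … 18` for all valuations and supports» (any of the `(3,4)` order-type laws of val-sym-trop-p5 g12), then `DesignRowD d v ε 33`: the
`(3,5)` cell on `d` is not counting-tight. [this file] -/
theorem designRowD_three_five_33_of_delete (d : Fin 5 → ℕ) (l : Fin 5)
    (h : ∀ v' ε' : Fin 3 → Fin 3 → Fin 4 → ℤ, DesignRowD (fun j => d (l.succAbove j)) v' ε' 18)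
    (v ε : Fin 3 → Fin 3 → Fin 5 → ℤ) : DesignRowD d v ε 33 := by
  have e4 : Nat.multichoose 4 3 - 2 = 18 := by rw [Nat.multichoose_eq]; decide
  have e5 : Nat.multichoose 5 3 - 2 = 33 := by rw [Nat.multichoose_eq]; decide
  have := designRowD_notTight_of_delete_succAbove (m := 3) (K := 3) (by norm_num) (by norm_num) d l (by rw [e4]; exact h) v ε
  rw [e5] at this
  exact this

/-- **WEDGE on the lower four classes ⇒ `(3,5)` not counting-tight**: `d 0 < d 1 ≤ d 2`, `d 0 + d 2 ≤ 2·d 1`, `3·d 1 < 2·d 0 + d 3`,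
`2·d 2 < d 0 + d 3` (val-sym-trop-p5's `designRowD_three_four_18_wedge` on `(d 0, d 1, d 2, d 3)`; the fifth exponent `d 4` is arbitrary). -/
theorem designRowD_three_five_33_wedge_low (d : Fin 5 → ℕ) (h1 : d 0 < d 1) (h2 : d 1 ≤ d 2) (h3 : d 0 + d 2 ≤ 2 * d 1)
    (h4 : 3 * d 1 < 2 * d 0 + d 3) (h5 : 2 * d 2 < d 0 + d 3) (v ε : Fin 3 → Fin 3 → Fin 5 → ℤ) : DesignRowD d v ε 33 :=
  designRowD_three_five_33_of_delete d (Fin.last 4) (fun v' ε' => by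
    have hw := ThreeFourCore.designRowD_three_four_18_wedge (fun j => d ((Fin.last 4).succAbove j))
    simp only [Fin.succAbove_last] at hw ⊢
    exact hw (by simpa using h1) (by simpa using h2) (by simpa using h3) (by simpa using h4) (by simpa using h5) v' ε') v ε

/-- **WEDGE on the upper four classes ⇒ `(3,5)` not counting-tight**: the same inequalities for `(d 1, d 2, d 3, d 4)` (delete class `0`). -/
theorem designRowD_three_five_33_wedge_high (d : Fin 5 → ℕ) (h1 : d 1 < d 2) (h2 : d 2 ≤ d 3) (h3 : d 1 + d 3 ≤ 2 * d 2)
    (h4 : 3 * d 2 < 2 * d 1 + d 4) (h5 : 2 * d 3 < d 1 + d 4) (v ε : Fin 3 → Fin 3 → Fin 5 → ℤ) : DesignRowD d v ε 33 :=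
  designRowD_three_five_33_of_delete d 0 (fun v' ε' => by
    have hw := ThreeFourCore.designRowD_three_four_18_wedge (fun j => d ((0 : Fin 5).succAbove j))
    simp only [Fin.succAbove_zero] at hw ⊢
    exact hw (by simpa using h1) (by simpa using h2) (by simpa using h3) (by simpa using h4) (by simpa using h5) v' ε') v ε

/-- **core law C1 on the lower four classes ⇒ `(3,5)` not counting-tight**: `d 1 + d 2 ≤ d 0 + d 3`, `d 3 + 2·d 0 < 3·d 1`, `3·d 1 < 2·d 2 + d 0`
(val-sym-trop-p5's `designRowD_three_four_18`). -/
theorem designRowD_three_five_33_core_low (d : Fin 5 → ℕ) (hA : d 1 + d 2 ≤ d 0 + d 3) (hB : d 3 + 2 * d 0 < 3 * d 1)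
    (hC : 3 * d 1 < 2 * d 2 + d 0) (v ε : Fin 3 → Fin 3 → Fin 5 → ℤ) : DesignRowD d v ε 33 :=
  designRowD_three_five_33_of_delete d (Fin.last 4) (fun v' ε' => by
    have hw := ThreeFourCore.designRowD_three_four_18 (fun j => d ((Fin.last 4).succAbove j))
    simp only [Fin.succAbove_last] at hw ⊢
    exact hw (by simpa using hA) (by simpa using hB) (by simpa using hC) v' ε') v ε

/-- the family `(0, 2, 3, N, D)`, `N ≥ 7`, ANY `D`: never counting-tight at `(3,5)` (val-sym-trop-p5's `(0,2,3,N)` wedge family, lifted). -/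
theorem designRowD_three_five_33_two_three (N D : ℕ) (hN : 7 ≤ N) (v ε : Fin 3 → Fin 3 → Fin 5 → ℤ) :
    DesignRowD ![0, 2, 3, N, D] v ε 33 :=
  designRowD_three_five_33_wedge_low _ (by simp) (by simp) (by simp) (by simp; omega) (by simp; omega) v ε

/-- the family `(0, a, a, N, D)`, `0 < a`, `3a < N`, any `D`: never counting-tight at `(3,5)`. -/
theorem designRowD_three_five_33_equal_middle (a N D : ℕ) (ha : 0 < a) (hN : 3 * a < N) (v ε : Fin 3 → Fin 3 → Fin 5 → ℤ) :
    DesignRowD ![0, a, a, N, D] v ε 33 :=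
  designRowD_three_five_33_wedge_low _ (by simpa using ha) (by simp) (by simp; omega) (by simp; omega) (by simp; omega) v ε

end Tightness

end Summit.ValiantsHypothesis.ValiantsHypothesis.Theorems.KPlusLogSqLaw
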